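import Mathlib
import HarnessLib
import Summits.Langlands.Langlands.Theses.MonomialConverse
import Literature.RepresentationTheory.FiniteGroups.MonomialCharacters

/-!
# Birth skeleton (BC3) for crux stmt-Langlands-18580
`Summit.Langlands.Langlands.Theses.MonomialConverse.AbelianFreeBrauer` — line `birth`

THE CRUX (finite group theory): for every finite group `G` and every irreducible complex
representation `V` of dimension `≥ 2`, the character of `V` is a `ℤ`-linear combination of induced
class functions `Ind_H^G φ` with `φ : H →* ℂˣ` a linear character of a subgroup `H` that is NOT the
restriction of a linear character of `G` ("abelian-free" monomial pieces).

## The line: minimal-counterexample trichotomy, over the in-tree character library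

Write `AFB(G)` for the crux at one group `G`.  Every argument on file for this crux (grounders
g79-1/g79-3, refuter REVIEW-MonomialConverse.md, rattack THEORY.md, crux ideas
`supplement-poset-snake`, `cyclotomic-torsion-afb`) has the shape
"`AFB(K)` for all groups `K` of smaller order **and** a structural hypothesis on `G` ⟹ `AFB(G)`",
after the elementary reformulation `AFB(G) ⟺ ∀ H ≤ G, π_H − Ind_{HG'}^G 1 ∈ M_G` (Brauer's theorem
in monomial form — PROVED in the tree, `brauer_induction_holds` — plus Frobenius reciprocity,
transitivity of induction and inflation, all proved in `Literature.RepresentationTheory.FiniteGroups`).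
The composition below is exactly that strong induction on `|G|`, with the three structural cases as
the stubs, stated in the LIBRARY vocabulary (`IsIrrChar`, `indClassFun`: plain class functions
`G → ℂ`), plus one dictionary stub carrying the library form back to the crux's own typing
(`FDRep ℂ G`, `CategoryTheory.Simple`, the `dite` Frobenius formula):

* `stub_dictionary` (S–M, provable now): library form `AFBAt G` ⟹ crux form `AFBCrux G` at each `G`
  (`Simple V ⟹ V.character ∈ irrChars G` via Mathlib's `FDRep.simple_iff_char_is_norm_one` and the
  tree's `Representation.exists_multiset_irrChars`; `FDRep.char_one` for the degree; reindexing
  `x ↦ x⁻¹` between `indClassFun` and the crux's sum).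
* `stub_radicalStep` (L, proved on paper, g79-3 + REVIEW): `G` has a non-trivial abelian normal
  subgroup and `AFB` holds below `|G|` ⟹ `AFB(G)` (reduction to a core-free maximal supplement `L` of
  `G'`; then `G = V ⋊ L` is affine and `π_L − 1 = Σ_{orbits ≠ 1} Ind_{V L_χ}^G χ̃` is abelian-free).
  Covers every solvable group.
* `stub_perfectStep` (M–L, proved on paper per REVIEW §(a) / THEORY §2): `G` perfect and `AFB` below
  `|G|` ⟹ `AFB(G)`; 54 perfect groups GAP-certified (SUMMARY.md).
* `stub_fittingFreeStep` (the OPEN sector, hardest): `G` with no non-trivial abelian normal subgroup,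
  not perfect, `AFB` below `|G|` ⟹ `AFB(G)` (`S_n`, `PGL₂(q)`, `PΓL₂(q)`, `M₁₀`, `Aut(T)`, `T ≀ C₂`, …;
  34 such groups certified, 0 FAIL; partial paper results: `|G:G'| = 2` (THEORY v2 §2b), `G/G'` a
  `p`-group (idea supplement-poset-snake), two non-cyclic Sylows of `G/G'` (idea cyclotomic-torsion)).

Composition `AbelianFreeBrauer_of : dictionary → radical → perfect → fittingFree → AbelianFreeBrauer`
(kernel-checked, no `sorry` outside the four `stub_*`): strong induction on `Fintype.card G`,
trichotomy by `Classical` case split, then the dictionary and `Iff.rfl`.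

Disproof used: none exists (`ledger crux ls stmt-Langlands-18580`: no workfiles, no `Disproof.lean`,
no `Negative/` lemma, 2026-08-17); `ledger negatives --problem Langlands` checked — none of the stubs'
shape.  No `_false_without_` theorem to honour.
-/

set_option linter.dupNamespace false
set_option linter.unusedVariables false

noncomputable section

namespace Summit.Langlands.Langlands.Cruxes.AbelianFreeBrauer.Birth

-- `Classical` as in the route file, so that `AFBCrux` is the crux's matrix syntactically (the `dite`
-- in the Frobenius formula is decided by `Classical.propDecidable`).
open scoped BigOperators Classical
open Summit.Langlands.Langlands.Theses.MonomialConverse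
open Literature.RepresentationTheory.FiniteGroups

/-! ## 0. Vocabulary -/

/-- **Abelian-free monomial `ℤ`-combination** (library form): `f = ∑ᵢ mᵢ · Ind_{Hᵢ}^G φᵢ` with
`φᵢ : Hᵢ →* ℂˣ` linear characters that are not restrictions of linear characters of `G`
(the abelian-free clause is the crux's, verbatim; `Ind` is the tree's `indClassFun`, Serre §7.2).
[cite: SerreLinearRepresentations1977, §7.2] -/
def IsAFMonomialZSum {G : Type} [Group G] [Fintype G] (f : G → ℂ) : Prop :=
  ∃ (ι : Type) (_ : Fintype ι) (H : ι → Subgroup G) (φ : ∀ i, H i →* ℂˣ) (m : ι → ℤ),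
    (∀ i, ∀ χ : G →* ℂˣ, χ.restrict (H i) ≠ φ i) ∧
      f = ∑ i, (m i : ℂ) • indClassFun (H i) (fun h => ((φ i h : ℂˣ) : ℂ))

/-- **`AFB` at the finite group `G`, library form**: every irreducible character of `G` of degree
`≠ 1` (i.e. `≥ 2`) is an abelian-free monomial `ℤ`-combination. [cite: Brauer1947] -/
def AFBAt (G : Type) [Group G] [Fintype G] : Prop :=
  ∀ χ : G → ℂ, IsIrrChar G χ → χ 1 ≠ 1 → IsAFMonomialZSum χ

/-- **`AFB` at the finite group `G`, crux form**: the matrix of the route decl `AbelianFreeBrauer`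
at one group, copied verbatim (`abelianFreeBrauer_iff` is `Iff.rfl`). [cite: Brauer1947] -/
def AFBCrux (G : Type) [Group G] [Fintype G] : Prop :=
  ∀ (V : FDRep ℂ G), CategoryTheory.Simple V → 2 ≤ Module.finrank ℂ V →
    ∃ (ι : Type) (_ : Fintype ι) (H : ι → Subgroup G) (φ : ∀ i, H i →* ℂˣ) (m : ι → ℤ),
      (∀ i, ∀ χ : G →* ℂˣ, χ.restrict (H i) ≠ φ i) ∧
        ∀ g : G, V.character g = ∑ i, (m i : ℂ) * ((Nat.card (H i) : ℂ)⁻¹ *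
          ∑ x : G, if h : x * g * x⁻¹ ∈ H i then ((φ i ⟨x * g * x⁻¹, h⟩ : ℂˣ) : ℂ) else 0)

/-- The crux is `∀ G, AFBCrux G`, definitionally. [folklore] -/
theorem abelianFreeBrauer_iff :
    AbelianFreeBrauer ↔ ∀ (G : Type) [Group G] [Fintype G], AFBCrux G :=
  Iff.rfl

/-! ## 1. The four stubs -/

/-- **STUB D — dictionary (size S–M, provable now).**  At each finite group `G`, the library form
of `AFB` implies the crux form: for `V : FDRep ℂ G` simple, `V.character` is an irreducible
character in the sense of `IsIrrChar` (Mathlib `FDRep.simple_iff_char_is_norm_one` + the tree's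
`Representation.exists_multiset_irrChars` / `classInner_multiset_sum_irrChars`: a character of norm
one is irreducible), `V.character 1 = finrank ≥ 2 ≠ 1` (`FDRep.char_one`), and the tree's
`indClassFun H φ g = |H|⁻¹ ∑_t φ̇(t⁻¹ g t)` is the crux's `|H|⁻¹ ∑_x φ̇(x g x⁻¹)` after `x ↦ x⁻¹`
(`Fintype.sum_equiv (Equiv.inv G)`, `extend_subtypeVal_apply` / `extend_subtypeVal_of_not_mem`).
[folklore] -/
theorem stub_dictionary :
    ∀ (G : Type) [Group G] [Fintype G], AFBAt G → AFBCrux G := by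
  sorry

/-- **STUB R — the radical step (size L; proved on paper, grounder g79-3 / REVIEW-MonomialConverse.md).**
If `G` has a non-trivial abelian normal subgroup and `AFB` holds for every group of smaller order,
then `AFB(G)`.  Paper proof: `AFB(G) ⟺ ∀ H ≤ G, δ_H := π_H − Ind_{HG'}^G 1 ∈ M_G` (Brauer monomial form
`brauer_induction_holds`, Frobenius reciprocity `classInner_indClassFun_left`, `χ · Ind_H φ = Ind_H (χ|_H φ)`);
`HG' < G`: `δ_H = Ind_{HG'}^G(π^{HG'}_H − 1)` lies in `M_G` by `AFB(HG')`, transitivity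
`indClassFun_indClassFun` and "a linear `ψ ≠ 1` of `HG'` trivial on `H` is not a restriction from `G`";
`HG' = G`: `π_H ≡ π_L (mod M_G)` for `H ≤ L` maximal, and `δ_L` inflates from `G/core(L)`
(`indClassFun_comp_mk`) unless `L` is core-free; then the abelian normal `V ⊄ L` gives `G = V ⋊ L`,
`ℂ[G/L] = ⊕_{L-orbits on V̂} Ind_{V L_χ}^G χ̃` (`character_eq_indClassFun_of_isInternal`), the orbit of
`1` gives `1_G`, every other orbit is non-singleton because `LG' = G`, so each `χ̃` is abelian-free.
Covers all solvable `G`. [cite: Brauer1947] [cite: SerreLinearRepresentations1977, §7.2, §10.5 Thm. 20] -/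
theorem stub_radicalStep :
    ∀ (G : Type) [Group G] [Fintype G],
      (∃ A : Subgroup G, A.Normal ∧ A ≠ ⊥ ∧ ∀ x ∈ A, ∀ y ∈ A, x * y = y * x) →
      (∀ (K : Type) [Group K] [Fintype K], Fintype.card K < Fintype.card G → AFBAt K) →
      AFBAt G := by
  sorry

/-- **STUB P — the perfect step (size M–L; proved on paper per REVIEW-MonomialConverse.md §(a) and
THEORY.md §2, two independent refuter seats).**  If `G` is perfect (`G' = G`) and `AFB` holds for
every group of smaller order, then `AFB(G)`.  Paper proof (REVIEW): with `Lin(G) = {1}`,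
`N_G = {f ∈ R(G) : ⟨f, 1⟩ = 0}` and `M_G ⊗ ℚ = N_G ⊗ ℚ` (a class function orthogonal to every
`Ind_C φ`, `φ ≠ 1`, `C` cyclic, is constant); the finite quotient `N/M` is dual to class functions
`ζ ∈ ℚ ⊗ N` with `ζ|_H ∈ R(H) + ℚ 1_H` for all `H < G` (uses `AFB(H)`), evaluation at `1` pins the
constants mod `ℤ`, and Brauer's characterisation of characters (`mem_brauerV_of_mem_virtChars`,
elementary subgroups are proper) gives `ζ ∈ R(G)`.  GAP: 54 perfect groups certified `N = M`
(SUMMARY.md).  Includes the trivial group (vacuous). [cite: Brauer1947] -/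
theorem stub_perfectStep :
    ∀ (G : Type) [Group G] [Fintype G], commutator G = ⊤ →
      (∀ (K : Type) [Group K] [Fintype K], Fintype.card K < Fintype.card G → AFBAt K) →
      AFBAt G := by
  sorry

/-- **STUB F — the Fitting-free imperfect step (the OPEN sector; hardest stub).**  If `G` has no
non-trivial abelian normal subgroup, is not perfect, and `AFB` holds for every group of smaller
order, then `AFB(G)`.  By the reduction of STUB R only a core-free maximal supplement `L` of `G'`
matters (`π_L − 1_G ∈ M_G`), i.e. `G` primitive with non-abelian socle and `G ≠ G'`: `S_n`
(⟺ `χ^{(n−1,1)} ∈ M(S_n)`), `PGL₂(q)`, `PΓL₂(q)`, `M₁₀`, `Aut(T)`, product/diagonal/twisted-wreath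
types.  Evidence: 34 such groups GAP-certified `N = M`, 0 FAIL (SUMMARY.md: `S5–S8`, `PGL(2,7…17)`,
`PΓL(2,8/9/16)`, `M10`, `GL(2,q)`, `A5≀S2`, …).  Partial paper results to build on: `|G:G'| = 2`
(THEORY v2 §2b: every outer element in a unique maximal subgroup forces `π_L − 1` supported on `G'`),
`G/G'` a `p`-group (snake lemma on Brauer surjectivity, idea supplement-poset-snake), `G/G'` with two
non-cyclic Sylows (idea cyclotomic-torsion-afb); named residual: monolithic groups with `|G/G'|` not a
prime power (`PΓL₂(27)`, `L₂(64).6`, `L₃(4).6`, `U₃(8).6`).  Why it might fail: a pure `ℤ`-lattice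
index obstruction `[N:M] > 1` in such a group (none found). [cite: Brauer1947]
[cite: doi:10.1016/0021-8693(88)90254-5] -/
theorem stub_fittingFreeStep :
    ∀ (G : Type) [Group G] [Fintype G],
      (¬ ∃ A : Subgroup G, A.Normal ∧ A ≠ ⊥ ∧ ∀ x ∈ A, ∀ y ∈ A, x * y = y * x) →
      commutator G ≠ ⊤ →
      (∀ (K : Type) [Group K] [Fintype K], Fintype.card K < Fintype.card G → AFBAt K) →
      AFBAt G := by
  sorry

/-! ## 2. The stub statements as named `Prop`s (literally their types) -/

namespace _Goal

/-- The statement of `stub_dictionary`, as a named `Prop` (literally its type). [folklore] -/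
def stub_dictionary : Prop :=
  type_of% @Summit.Langlands.Langlands.Cruxes.AbelianFreeBrauer.Birth.stub_dictionary

/-- The statement of `stub_radicalStep`, as a named `Prop` (literally its type). [folklore] -/
def stub_radicalStep : Prop :=
  type_of% @Summit.Langlands.Langlands.Cruxes.AbelianFreeBrauer.Birth.stub_radicalStep

/-- The statement of `stub_perfectStep`, as a named `Prop` (literally its type). [folklore] -/
def stub_perfectStep : Prop :=
  type_of% @Summit.Langlands.Langlands.Cruxes.AbelianFreeBrauer.Birth.stub_perfectStep

/-- The statement of `stub_fittingFreeStep`, as a named `Prop` (literally its type). [folklore] -/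
def stub_fittingFreeStep : Prop :=
  type_of% @Summit.Langlands.Langlands.Cruxes.AbelianFreeBrauer.Birth.stub_fittingFreeStep

end _Goal

/-! ## 3. The composition (kernel-checked, no `sorry`): strong induction on `|G|` -/

/-- **`AFB` at every finite group from the three step stubs**, by strong induction on
`Fintype.card G` and the trichotomy "non-trivial abelian normal subgroup / perfect / neither".
[folklore] -/
theorem afbAt_of_steps (hR : _Goal.stub_radicalStep) (hP : _Goal.stub_perfectStep)
    (hF : _Goal.stub_fittingFreeStep) :
    ∀ (G : Type) [Group G] [Fintype G], AFBAt G := by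
  unfold _Goal.stub_radicalStep at hR
  unfold _Goal.stub_perfectStep at hP
  unfold _Goal.stub_fittingFreeStep at hF
  suffices key : ∀ n : ℕ, ∀ (G : Type) [Group G] [Fintype G], Fintype.card G = n → AFBAt G from
    fun G _ _ => key _ G rfl
  intro n
  induction n using Nat.strong_induction_on with
  | _ n ih =>
    intro G _ _ hn
    have IH : ∀ (K : Type) [Group K] [Fintype K], Fintype.card K < Fintype.card G → AFBAt K :=
      fun K _ _ hK => ih (Fintype.card K) (hn ▸ hK) K rfl
    by_cases hA : ∃ A : Subgroup G, A.Normal ∧ A ≠ ⊥ ∧ ∀ x ∈ A, ∀ y ∈ A, x * y = y * x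
    · exact hR G hA IH
    · by_cases hp : commutator G = ⊤
      · exact hP G hp IH
      · exact hF G hA hp IH

/-- **`AbelianFreeBrauer` from the four stubs.**  The hypotheses are, verbatim, the statements of
the four stubs; the conclusion is the route decl
`Summit.Langlands.Langlands.Theses.MonomialConverse.AbelianFreeBrauer`, by name. [folklore] -/
theorem AbelianFreeBrauer_of (hD : _Goal.stub_dictionary) (hR : _Goal.stub_radicalStep)
    (hP : _Goal.stub_perfectStep) (hF : _Goal.stub_fittingFreeStep) :
    Summit.Langlands.Langlands.Theses.MonomialConverse.AbelianFreeBrauer := by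
  have hall := afbAt_of_steps hR hP hF
  unfold _Goal.stub_dictionary at hD
  rw [abelianFreeBrauer_iff]
  intro G _ _
  exact hD G (hall G)

/-- The same composition with the four registered stubs consumed BY NAME (inherits their
`sorry`s, contains none). [folklore] -/
theorem AbelianFreeBrauer_of_stubs :
    Summit.Langlands.Langlands.Theses.MonomialConverse.AbelianFreeBrauer :=
  AbelianFreeBrauer_of stub_dictionary stub_radicalStep stub_perfectStep stub_fittingFreeStep

end Summit.Langlands.Langlands.Cruxes.AbelianFreeBrauer.Birth

end
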